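/-
Copyright (c) 2026 the pub-hodgecm-mathlib formalisation cell (harness21).  Prover seat hodgecm-mathlib-LH4-p09 (g8), req620 Track A «(D-RAM) FOUR-FRAME» squad
(heir LEAD F0P3a-plan (g20) T19-24 «STAGE-1b PRE-SCOPING BY IDLE HANDS: ALLOWED AS SCOPING»; dealer LH4-plan (g12) WORD #49 «(L-model-G)»; heir dealer LH4-plan (g13)).  2026-09-04.
-/
import Summits.HodgeConjecture.HodgeConjecture.Theorems.F0P3cDyRamLabelledGluedLocusCensus    -- (this seat): on-locus census in `R`-currency (tube ∕ foot), tube closed form; brings ★ F3a, ★ (iv-c), ★ bridge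
import HarnessLib

/-!
# (D-RAM) four-frame, STAGE 1b scoping — unit (L-model-G) item (1), HEADS continued: the labelled glued stratum G1 on the cancellation locus — the FOOT
# census in closed form (two balls on the glue invariant, nested or disjoint), and the MODEL TOKEN `D₁ = diag(α−1, β−1, 0)` made fully numeric by the ★ bridge

STAGE-1b SCOPING BRICK in the sense of heir LEAD F0P3a-plan (g20) T19-24 and dealer LH4-plan (g12) WORD #49 (unit «(L-model-G)», item (1)): `Theorems/` only,
statement-first, ★-only imports, helper lane `--supports stmt-HodgeConjecture-24833 --as helper`; it PAYS NO tier-0 row and states no STAGE-1b law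
(count-neutral; rule 66: a census, not a law).

THE FOOT.  On the glue foot (`n₁ = n₂ + 2t′`, `ρ ≤ n₂ < 2ρ`) and on the locus (`v(e₂−e₀) = k`, `v(e₂−e₁) = k + 2t′`) the label-cut G1 weight is
`[outer] · #{g ∈ R : |g + g₀| ≤ |ϖ|^{e₀} ∧ |ϖ|^k·|g + g_e| ≤ |ϖ|^{ℓ+2ρ+2t′}} · q^{ρ+⌊(ρ+2t′)∕2⌋}` (`g₀ = (β−1)∕(α−1)`, `e₀ = 2ρ + 2t′ − n₂`; previous file).  Two
balls in an ultrametric field are nested or disjoint, and a member of `R` lying in both is itself a `σ`-fixed witness; so with `E = ℓ + 2ρ + 2t′ − k`: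
`Σᶠ_{M ∈ G1, diag(e)M ⊆ ϖ^ℓM} w = [|eᵢ| ≤ |ϖ|^ℓ ∧ ℓ+ρ ≤ k] · { ★ B56's foot value q^{2ρ+t′−⌈(2ρ−n₂)∕2⌉}·[∃ f₀ = σf₀ : |f₀+g₀| ≤ |ϖ|^{e₀}] if ℓ+2ρ ≤ k ;`
`q^{2ρ+2t′−⌈max(e₀,E)∕2⌉}·[∃ f₀ = σf₀ : |f₀+g₀| ≤ |ϖ|^{e₀} ∧ |f₀+g_e| ≤ |ϖ|^E] if ℓ+ρ ≤ k < ℓ+2ρ }` (§2).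
THE MODEL TOKEN `D₁`.  For `e = (α−1, β−1, 0)`: `k = n₂`, `v(e₂−e₁) = n₁`, so the locus IS the glue-foot relation `n₁ = n₂ + 2t′`, and `g_e = (1−β)∕(1−α) = g₀`
LITERALLY; the outer conjuncts collapse to `ℓ + ρ ≤ n₂`, the two balls are concentric, and ★ `exists_fixed_v_add_glueUnit_le_iff` turns the residual
indicator into `ℓ + 2ρ − n₂ ≤ n₂ − d + 1` (§3: tube-on-locus and foot, fully numeric; off the locus ★ p859257 applies).

* §1 `ball_of_witness` (ultrametric nesting with a common witness), `v_glueUnit_eq`, `glueRatio_modelToken_eq`.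
* §2 **`finsum_stabiliserWeight_stratum_G1_sep_onLocus_foot`** — the FOOT census in closed form.
* §3 **`finsum_stabiliserWeight_stratum_G1_sep_modelToken_tube`**, **`finsum_stabiliserWeight_stratum_G1_sep_modelToken_foot`** — the labelled G1 weight for
  the model token `diag(α−1, β−1, 0)` on its locus `n₁ = n₂ + 2t′`, numeric in `(q; ρ, t′, ℓ, n₂, d)`.

HONEST LABEL: scoping inventory; STAGE-1b tier-0 rows T₊∕T₋∕regular stay OPEN; HC_CM is proved only modulo the 7 printed citations (2 remaining named
inputs: hLiu418 = `stmt-HodgeConjecture-24832`, h413 = `stmt-HodgeConjecture-24833`) until rung 0 closes.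

## References
* [Kottwitz1986BaseChangeUnits] R. E. Kottwitz, *Base change for unit elements of Hecke algebras*, Compositio Math. 60 (1986), §1 pp. 240–241 (lattice counts via torus orbits and stabilisers).
* [Rogawski1990] J. D. Rogawski, *Automorphic Representations of Unitary Groups in Three Variables*, Ann. of Math. Stud. 123 (1990), §4.9 Prop. 4.9.1 (a) p. 55.
* [Serre1979] J.-P. Serre, *Local Fields*, GTM 67 (1979), Ch. IV §2 Prop. 6 (unit filtration counts behind ★ (iv-c) ∕ ★ F3a ∕ the ★ bridge).
* [Serre1980Trees] J.-P. Serre, *Trees*, Springer (1980), Ch. II §1.1 (the ultrametric inequality: balls are nested or disjoint).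
-/

set_option autoImplicit false

noncomputable section

namespace Summit.HodgeConjecture.HodgeConjecture.Cruxes.H413.F0P3cDyRamLabelledGluedLocusCensusFoot

open Matrix WithZero
open Literature.NumberTheory.Automorphic Literature.NumberTheory.Automorphic.HermitianLattice
open Literature.NumberTheory.Automorphic.UnitaryLatticeTree Literature.NumberTheory.Automorphic.UnitaryThreeFourFrame
open Literature.NumberTheory.LocalFields.WildQuadraticDatum
open Summit.HodgeConjecture.HodgeConjecture.Cruxes.H413.F0P3cDyRamDiagonalTorusDefs
open Summit.HodgeConjecture.HodgeConjecture.Cruxes.H413.F0P3cDyRamDiagonalStrataDefs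
open Summit.HodgeConjecture.HodgeConjecture.Cruxes.H413.F0P3cDyRamDiagonalGluedStabiliserIndex (ne_zero_and_v_lt_one_of_v_eq_exp)
open Summit.HodgeConjecture.HodgeConjecture.Cruxes.H413.F0P3cDyRamDiagonalGluedFootClasses
open Summit.HodgeConjecture.HodgeConjecture.Cruxes.H413.F0P3cDyRamDiagonalGluedClassRepresentatives (exists_fixed_class_representatives)
open Summit.HodgeConjecture.HodgeConjecture.Cruxes.H413.F0P3cDyRamGlueUnitRationalityDepth (exists_fixed_v_add_glueUnit_le_iff)
open Summit.HodgeConjecture.HodgeConjecture.Cruxes.H413.F0P3cDyRamFourFrameCensusDefs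
open Summit.HodgeConjecture.HodgeConjecture.Cruxes.H413.F0P3cDyRamLabelledGluedClassCut
open Summit.HodgeConjecture.HodgeConjecture.Cruxes.H413.F0P3cDyRamLabelledGluedLocusCensus
open scoped Valued WithZero Matrix MatrixGroups

/-! ## §1  Ultrametric nesting with a witness; the glue unit; the model token -/

section Tools

variable {K : Type*} [Field K] [Valued K ℤᵐ⁰]

/-- **TWO BALLS WITH A COMMON POINT ARE NESTED**: if `|f + u| ≤ |ϖ|^m`, `|f + w| ≤ |ϖ|^M`, `m ≤ M`, then the finer ball lies in the coarser one:
`|g + w| ≤ |ϖ|^M ⇒ |g + u| ≤ |ϖ|^m` (`g + u = (g + w) + (f + u) − (f + w)`). [cite: Serre1980Trees, II §1.1] -/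
theorem ball_of_witness {ϖ : K} (hϖ1 : Valued.v ϖ ≤ 1) {f u w g : K} {m M : ℕ} (hfu : Valued.v (f + u) ≤ Valued.v ϖ ^ m)
    (hfw : Valued.v (f + w) ≤ Valued.v ϖ ^ M) (hmM : m ≤ M) (hg : Valued.v (g + w) ≤ Valued.v ϖ ^ M) : Valued.v (g + u) ≤ Valued.v ϖ ^ m := by
  have hMm : Valued.v ϖ ^ M ≤ Valued.v ϖ ^ m := pow_le_pow_right_of_le_one' hϖ1 hmM
  rw [show g + u = ((g + w) + (f + u)) - (f + w) by ring]
  exact Valuation.map_sub_le _ (Valuation.map_add_le _ (hg.trans hMm) hfu) (hfw.trans hMm)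

/-- `|g₀| = |(β−1)∕(α−1)| = |ϖ|^{2t′}` on the glue foot `|β−1| = |ϖ|^{n₂+2t′}`, `|α−1| = |ϖ|^{n₂}`. [cite: Serre1980Trees, II §1.1] -/
theorem v_glueUnit_eq {ϖ : K} (hvϖ0 : Valued.v ϖ ≠ 0) {α β : K} {n₂ t' : ℕ} (h₁ : Valued.v (β - 1) = Valued.v ϖ ^ (n₂ + 2 * t'))
    (h₂ : Valued.v (α - 1) = Valued.v ϖ ^ n₂) : Valued.v ((β - 1) / (α - 1)) = Valued.v ϖ ^ (2 * t') := by
  rw [map_div₀, h₁, h₂, pow_add, mul_div_cancel_left₀ _ (pow_ne_zero n₂ hvϖ0)]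

omit [Valued K ℤᵐ⁰] in
/-- For the model token `e = (α−1, β−1, 0)`: `g_e = (e₂ − e₁)∕(e₂ − e₀) = (β−1)∕(α−1) = g₀`. [cite: Kottwitz1986BaseChangeUnits, §1 pp. 240–241] -/
theorem glueRatio_modelToken_eq (α β : K) :
    ((![α - 1, β - 1, 0] : Fin 3 → K) 2 - (![α - 1, β - 1, 0] : Fin 3 → K) 1) / ((![α - 1, β - 1, 0] : Fin 3 → K) 2 - (![α - 1, β - 1, 0] : Fin 3 → K) 0) =
      (β - 1) / (α - 1) := by
  simp only [Matrix.cons_val_zero, Matrix.cons_val_one, Matrix.cons_val_two, Matrix.tail_cons, Matrix.head_cons, zero_sub]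
  rw [neg_div_neg_eq]

end Tools

/-! ## §2  The foot census in closed form -/

section Foot

variable {K : Type} [Field K] [Valued K ℤᵐ⁰] [Fintype 𝓀[K]] {σ : K →+* K} {ϖ : K} {d t : ℕ} {α β : K} {N₀ n₁ n₂ n₃ : ℕ} {T : GL (Fin 3) K}

open Classical in
/-- **HEAD — THE LABELLED G1 WEIGHT ON THE LOCUS, FOOT REGIME, CLOSED FORM** (glue foot `n₁ = n₂ + 2t′`, `ρ ≤ n₂ < 2ρ`; `v(e₂−e₀) = k`, `v(e₂−e₁) = k + 2t′`,
`t′ ≥ 1`; `g₀ = (β−1)∕(α−1)`, `g_e = (e₂−e₁)∕(e₂−e₀)`, `e₀ = 2ρ + 2t′ − n₂`, `E = ℓ + 2ρ + 2t′ − k`):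
`Σᶠ_{M ∈ G1, diag(e)M ⊆ ϖ^ℓM} 1∕[𝒰 : S_F(M)] = [|eᵢ| ≤ |ϖ|^ℓ ∧ ℓ+ρ ≤ k] · ( q^{2ρ+t′−⌈(2ρ−n₂)∕2⌉}·[∃ f₀ = σf₀ : |f₀+g₀| ≤ |ϖ|^{e₀}] if ℓ+2ρ ≤ k (vacuous: ★ B56's foot value) ;`
`q^{2ρ+2t′−⌈max(e₀,E)∕2⌉}·[∃ f₀ = σf₀ : |f₀+g₀| ≤ |ϖ|^{e₀} ∧ |f₀+g_e| ≤ |ϖ|^E] otherwise )` — two balls on the glue invariant, nested as soon as a fixed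
point lies in both (§1), counted by ★ F3a over ★ (iv-c). [cite: Kottwitz1986BaseChangeUnits, §1 pp. 240–241] [cite: Serre1979, Ch. IV §2 Prop. 6]
[cite: Rogawski1990, §4.9 Prop. 4.9.1 (a) p. 55] -/
theorem finsum_stabiliserWeight_stratum_G1_sep_onLocus_foot (hD : IsRamifiedQuadraticDatum σ ϖ d t) (h2 : Valued.v (2 : K) < 1)
    (hE : IsElementDatum σ ϖ N₀ α β n₁ n₂ n₃) (hT : (T : Matrix (Fin 3) (Fin 3) K) = Matrix.diagonal ![α, β, 1])
    (ρ t' : ℕ) (hρ : 1 ≤ ρ) (ht' : 1 ≤ t') (hfoot : n₁ = n₂ + 2 * t') (hρm : ρ ≤ n₂) (hm : n₂ < 2 * ρ) (ℓ k : ℕ) (e : Fin 3 → K)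
    (hk : Valued.v (e 2 - e 0) = Valued.v ϖ ^ k) (hloc : Valued.v (e 2 - e 1) = Valued.v ϖ ^ (k + 2 * t')) :
    ∑ᶠ M ∈ {M | M ∈ stratum σ ϖ T ![2 * ρ, 2 * ρ + 2 * t', 2 * ρ + 2 * t'] ∧ LatticeInLevel ϖ ℓ (Matrix.diagonal e) M}, stabiliserWeight σ M =
      if (Valued.v (e 0) ≤ Valued.v ϖ ^ ℓ ∧ Valued.v (e 1) ≤ Valued.v ϖ ^ ℓ ∧ Valued.v (e 2) ≤ Valued.v ϖ ^ ℓ) ∧ ℓ + ρ ≤ k then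
        (if ℓ + 2 * ρ ≤ k then
            (if ∃ f : K, σ f = f ∧ Valued.v (f + (β - 1) / (α - 1)) ≤ Valued.v ϖ ^ (2 * ρ + 2 * t' - n₂)
              then (Fintype.card 𝓀[K] : ℚ) ^ (2 * ρ + t' - (2 * ρ - n₂ + 1) / 2) else 0)
          else
            (if ∃ f : K, σ f = f ∧ Valued.v (f + (β - 1) / (α - 1)) ≤ Valued.v ϖ ^ (2 * ρ + 2 * t' - n₂) ∧
                Valued.v (f + (e 2 - e 1) / (e 2 - e 0)) ≤ Valued.v ϖ ^ (ℓ + 2 * ρ + 2 * t' - k)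
              then (Fintype.card 𝓀[K] : ℚ) ^ (2 * ρ + 2 * t' - (max (2 * ρ + 2 * t' - n₂) (ℓ + 2 * ρ + 2 * t' - k) + 1) / 2) else 0))
      else 0 := by
  classical
  have hσ : ∀ x, σ (σ x) = x := hD.1
  have hvσ : ∀ a, Valued.v (σ a) = Valued.v a := hD.2.1
  have hϖ : Valued.v ϖ = exp (-1 : ℤ) := hD.2.2.1
  have hfix : ∀ x : K, σ x = x → x ≠ 0 → ∃ n : ℤ, Valued.v x = exp (2 * n) := hD.2.2.2.1
  have hd : Valued.v (ϖ - σ ϖ) = Valued.v ϖ ^ d := hD.2.2.2.2.1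
  have h₁ : Valued.v (β - 1) = Valued.v ϖ ^ (n₂ + 2 * t') := by rw [← hfoot]; exact hE.2.2.2.2.2.1
  have h₂ : Valued.v (α - 1) = Valued.v ϖ ^ n₂ := hE.2.2.2.2.2.2.1
  obtain ⟨hϖ0, hϖ1⟩ := ne_zero_and_v_lt_one_of_v_eq_exp hϖ
  have hvϖ0 : Valued.v ϖ ≠ 0 := (Valuation.ne_zero_iff _).2 hϖ0
  have hg₀ : Valued.v ((β - 1) / (α - 1)) = Valued.v ϖ ^ (2 * t') := v_glueUnit_eq hvϖ0 h₁ h₂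
  have hge : Valued.v ((e 2 - e 1) / (e 2 - e 0)) = Valued.v ϖ ^ (2 * t') := v_glueRatio_eq hϖ0 hk hloc
  obtain ⟨R, hRfin, -, hR1, hR2, hR3⟩ := exists_fixed_class_representatives hσ hvσ hfix hϖ hd ρ t' hρ
  rw [finsum_stabiliserWeight_stratum_G1_sep_onLocus_foot_eq_ncard_mul hD h2 hE hT ρ t' hρ ht' hfoot hρm hm ℓ k e hk hloc hRfin hR1 hR2 hR3]
  by_cases hout : (Valued.v (e 0) ≤ Valued.v ϖ ^ ℓ ∧ Valued.v (e 1) ≤ Valued.v ϖ ^ ℓ ∧ Valued.v (e 2) ≤ Valued.v ϖ ^ ℓ) ∧ ℓ + ρ ≤ k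
  · rw [if_pos hout, if_pos hout, ← Nat.card_eq_fintype_card]
    by_cases hvac : ℓ + 2 * ρ ≤ k
    · -- vacuous regime: the token ball is automatic, ★ F3a counts the stability ball
      have hall : {g ∈ R | Valued.v (g + (β - 1) / (α - 1)) ≤ Valued.v ϖ ^ (2 * ρ + 2 * t' - n₂) ∧
            Valued.v ϖ ^ k * Valued.v (g + (e 2 - e 1) / (e 2 - e 0)) ≤ Valued.v ϖ ^ (ℓ + 2 * ρ + 2 * t')} =
          {g ∈ R | Valued.v (g + (β - 1) / (α - 1)) ≤ Valued.v ϖ ^ (2 * ρ + 2 * t' - n₂)} :=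
        Set.ext fun g => ⟨fun h => ⟨h.1, h.2.1⟩, fun h => ⟨h.1, h.2, tokenBall_of_le hϖ1.le hvac (hR1 g h.1).2 hge⟩⟩
      rw [if_pos hvac, hall]
      by_cases hrat : ∃ f : K, σ f = f ∧ Valued.v (f + (β - 1) / (α - 1)) ≤ Valued.v ϖ ^ (2 * ρ + 2 * t' - n₂)
      · rw [if_pos hrat]
        obtain ⟨f₀, hσf₀, hf₀⟩ := hrat
        rw [ncard_glue_representatives_eq hσ hvσ hfix hϖ hd (by omega) (by omega) hRfin hR1 hR2 hR3 hg₀ hσf₀ hf₀,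
          show 2 * ρ + t' - (2 * ρ - n₂ + 1) / 2 = (ρ + 2 * t' + 1) / 2 - (2 * ρ + 2 * t' - n₂ + 1) / 2 + (ρ + (ρ + 2 * t') / 2) by omega, pow_add]
        push_cast
        ring
      · rw [if_neg hrat, glue_representatives_eq_empty hR1 hrat, Set.ncard_empty, Nat.cast_zero, zero_mul]
    · -- genuine regime: two balls
      rw [if_neg hvac]
      have hEeq : ℓ + 2 * ρ + 2 * t' = k + (ℓ + 2 * ρ + 2 * t' - k) := by omega
      have hball : {g ∈ R | Valued.v (g + (β - 1) / (α - 1)) ≤ Valued.v ϖ ^ (2 * ρ + 2 * t' - n₂) ∧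
            Valued.v ϖ ^ k * Valued.v (g + (e 2 - e 1) / (e 2 - e 0)) ≤ Valued.v ϖ ^ (ℓ + 2 * ρ + 2 * t')} =
          {g ∈ R | Valued.v (g + (β - 1) / (α - 1)) ≤ Valued.v ϖ ^ (2 * ρ + 2 * t' - n₂) ∧
            Valued.v (g + (e 2 - e 1) / (e 2 - e 0)) ≤ Valued.v ϖ ^ (ℓ + 2 * ρ + 2 * t' - k)} :=
        Set.ext fun g => by rw [Set.mem_setOf_eq, Set.mem_setOf_eq, tokenBall_iff_of_add_eq hϖ0 hEeq]
      rw [hball]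
      by_cases hrat : ∃ f : K, σ f = f ∧ Valued.v (f + (β - 1) / (α - 1)) ≤ Valued.v ϖ ^ (2 * ρ + 2 * t' - n₂) ∧
          Valued.v (f + (e 2 - e 1) / (e 2 - e 0)) ≤ Valued.v ϖ ^ (ℓ + 2 * ρ + 2 * t' - k)
      · rw [if_pos hrat]
        obtain ⟨f₀, hσf₀, hf₀, hf₀'⟩ := hrat
        by_cases hle : 2 * ρ + 2 * t' - n₂ ≤ ℓ + 2 * ρ + 2 * t' - k
        · -- the token ball is the finer one
          have hnest : {g ∈ R | Valued.v (g + (β - 1) / (α - 1)) ≤ Valued.v ϖ ^ (2 * ρ + 2 * t' - n₂) ∧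
                Valued.v (g + (e 2 - e 1) / (e 2 - e 0)) ≤ Valued.v ϖ ^ (ℓ + 2 * ρ + 2 * t' - k)} =
              {g ∈ R | Valued.v (g + (e 2 - e 1) / (e 2 - e 0)) ≤ Valued.v ϖ ^ (ℓ + 2 * ρ + 2 * t' - k)} :=
            Set.ext fun g => ⟨fun h => ⟨h.1, h.2.2⟩, fun h => ⟨h.1, ball_of_witness hϖ1.le hf₀ hf₀' hle h.2, h.2⟩⟩
          rw [hnest, max_eq_right hle, ncard_glue_representatives_eq hσ hvσ hfix hϖ hd (by omega) (by omega) hRfin hR1 hR2 hR3 hge hσf₀ hf₀',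
            show 2 * ρ + 2 * t' - (ℓ + 2 * ρ + 2 * t' - k + 1) / 2 =
              (ρ + 2 * t' + 1) / 2 - (ℓ + 2 * ρ + 2 * t' - k + 1) / 2 + (ρ + (ρ + 2 * t') / 2) by omega, pow_add]
          push_cast
          ring
        · -- the stability ball is the finer one
          have hle' : ℓ + 2 * ρ + 2 * t' - k ≤ 2 * ρ + 2 * t' - n₂ := by omega
          have hnest : {g ∈ R | Valued.v (g + (β - 1) / (α - 1)) ≤ Valued.v ϖ ^ (2 * ρ + 2 * t' - n₂) ∧
                Valued.v (g + (e 2 - e 1) / (e 2 - e 0)) ≤ Valued.v ϖ ^ (ℓ + 2 * ρ + 2 * t' - k)} =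
              {g ∈ R | Valued.v (g + (β - 1) / (α - 1)) ≤ Valued.v ϖ ^ (2 * ρ + 2 * t' - n₂)} :=
            Set.ext fun g => ⟨fun h => ⟨h.1, h.2.1⟩, fun h => ⟨h.1, h.2, ball_of_witness hϖ1.le hf₀' hf₀ hle' h.2⟩⟩
          rw [hnest, max_eq_left hle', ncard_glue_representatives_eq hσ hvσ hfix hϖ hd (by omega) (by omega) hRfin hR1 hR2 hR3 hg₀ hσf₀ hf₀,
            show 2 * ρ + 2 * t' - (2 * ρ + 2 * t' - n₂ + 1) / 2 =
              (ρ + 2 * t' + 1) / 2 - (2 * ρ + 2 * t' - n₂ + 1) / 2 + (ρ + (ρ + 2 * t') / 2) by omega, pow_add]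
          push_cast
          ring
      · -- no fixed point in both balls: a member of `R` in both would be one
        rw [if_neg hrat]
        have hemp : {g ∈ R | Valued.v (g + (β - 1) / (α - 1)) ≤ Valued.v ϖ ^ (2 * ρ + 2 * t' - n₂) ∧
            Valued.v (g + (e 2 - e 1) / (e 2 - e 0)) ≤ Valued.v ϖ ^ (ℓ + 2 * ρ + 2 * t' - k)} = ∅ :=
          Set.eq_empty_of_forall_notMem fun g ⟨hgR, hg₁, hg₂⟩ => hrat ⟨g, (hR1 g hgR).1, hg₁, hg₂⟩
        rw [hemp, Set.ncard_empty, Nat.cast_zero, zero_mul]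
  · rw [if_neg hout, if_neg hout]

end Foot

/-! ## §3  The model token `D₁ = diag(α−1, β−1, 0)` on its locus `n₁ = n₂ + 2t′`: fully numeric -/

section Model

variable {K : Type} [Field K] [Valued K ℤᵐ⁰] [Fintype 𝓀[K]] {σ : K →+* K} {ϖ : K} {d t : ℕ} {α β : K} {N₀ n₁ n₂ n₃ : ℕ} {T : GL (Fin 3) K}

omit [Fintype 𝓀[K]] in
/-- The valuation data of the model token `e = (α−1, β−1, 0)` on the locus `n₁ = n₂ + 2t′`: `v(e₂−e₀) = n₂`, `v(e₂−e₁) = n₂ + 2t′`, and the outer token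
conjuncts `[|eᵢ| ≤ |ϖ|^ℓ] ∧ ℓ + ρ ≤ n₂` collapse to `ℓ + ρ ≤ n₂`. [cite: Kottwitz1986BaseChangeUnits, §1 pp. 240–241] -/
theorem modelToken_data {ϖ α β : K} (hϖ : Valued.v ϖ = exp (-1 : ℤ)) {n₁ n₂ t' : ℕ} (h₁ : Valued.v (β - 1) = Valued.v ϖ ^ n₁)
    (h₂ : Valued.v (α - 1) = Valued.v ϖ ^ n₂) (hfoot : n₁ = n₂ + 2 * t') (ℓ ρ : ℕ) :
    Valued.v ((![α - 1, β - 1, 0] : Fin 3 → K) 2 - (![α - 1, β - 1, 0] : Fin 3 → K) 0) = Valued.v ϖ ^ n₂ ∧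
      Valued.v ((![α - 1, β - 1, 0] : Fin 3 → K) 2 - (![α - 1, β - 1, 0] : Fin 3 → K) 1) = Valued.v ϖ ^ (n₂ + 2 * t') ∧
      (((Valued.v ((![α - 1, β - 1, 0] : Fin 3 → K) 0) ≤ Valued.v ϖ ^ ℓ ∧ Valued.v ((![α - 1, β - 1, 0] : Fin 3 → K) 1) ≤ Valued.v ϖ ^ ℓ ∧
          Valued.v ((![α - 1, β - 1, 0] : Fin 3 → K) 2) ≤ Valued.v ϖ ^ ℓ) ∧ ℓ + ρ ≤ n₂) ↔ ℓ + ρ ≤ n₂) := by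
  have hp : ∀ m n : ℕ, Valued.v ϖ ^ m ≤ Valued.v ϖ ^ n ↔ n ≤ m := fun m n => UnitaryLatticeTree.v_pow_le_v_pow_iff hϖ m n
  simp only [Matrix.cons_val_zero, Matrix.cons_val_one, Matrix.cons_val_two, Matrix.tail_cons, Matrix.head_cons, zero_sub, Valuation.map_neg,
    h₁, h₂, hfoot, map_zero, zero_le, and_true, true_and, hp]
  exact ⟨fun h => h.2, fun h => ⟨⟨by omega, by omega⟩, h⟩⟩

/-- **HEAD — THE LABELLED G1 WEIGHT FOR THE MODEL TOKEN `D₁ = diag(α−1, β−1, 0)`, TUBE ON THE LOCUS** (`2ρ + 2t′ ≤ n₁ = n₂ + 2t′`, so `2ρ ≤ n₂`; level `ℓ`;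
`E = ℓ + 2ρ + 2t′ − n₂`): `Σᶠ_{M ∈ G1(2ρ, 2ρ+2t′, 2ρ+2t′), D₁M ⊆ ϖ^ℓM} 1∕[𝒰 : S_F(M)] =`
`[ℓ + ρ ≤ n₂] · ( (q−1)q^{2ρ+t′−1} if ℓ + 2ρ ≤ n₂ ;  q^{2ρ+2t′−⌈E∕2⌉}·[ℓ + 2ρ − n₂ ≤ n₂ − d + 1] otherwise )` — §2's tube census with `g_e = g₀` and the
★ bridge `exists_fixed_v_add_glueUnit_le_iff` (`n₃ = n₂` on the locus by ★ isoceles). [cite: Kottwitz1986BaseChangeUnits, §1 pp. 240–241]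
[cite: Serre1979, Ch. IV §2 Prop. 6] [cite: Rogawski1990, §4.9 Prop. 4.9.1 (a) p. 55] -/
theorem finsum_stabiliserWeight_stratum_G1_sep_modelToken_tube (hD : IsRamifiedQuadraticDatum σ ϖ d t) (h2 : Valued.v (2 : K) < 1)
    (hE : IsElementDatum σ ϖ N₀ α β n₁ n₂ n₃) (hN₀ : d ≤ N₀) (hT : (T : Matrix (Fin 3) (Fin 3) K) = Matrix.diagonal ![α, β, 1])
    (ρ t' : ℕ) (hρ : 1 ≤ ρ) (ht' : 1 ≤ t') (hfoot : n₁ = n₂ + 2 * t') (htube : 2 * ρ ≤ n₂) (ℓ : ℕ) :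
    ∑ᶠ M ∈ {M | M ∈ stratum σ ϖ T ![2 * ρ, 2 * ρ + 2 * t', 2 * ρ + 2 * t'] ∧ LatticeInLevel ϖ ℓ (Matrix.diagonal ![α - 1, β - 1, 0]) M},
        stabiliserWeight σ M =
      if ℓ + ρ ≤ n₂ then
        (if ℓ + 2 * ρ ≤ n₂ then ((Fintype.card 𝓀[K] : ℚ) - 1) * (Fintype.card 𝓀[K] : ℚ) ^ (2 * ρ + t' - 1)
          else if ℓ + 2 * ρ - n₂ ≤ n₂ - d + 1 then (Fintype.card 𝓀[K] : ℚ) ^ (2 * ρ + 2 * t' - (ℓ + 2 * ρ + 2 * t' - n₂ + 1) / 2) else 0)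
      else 0 := by
  classical
  obtain ⟨hσ, hvσ, hϖ, hfix, hd, hd1, -⟩ := id hD
  obtain ⟨hαn, hβn, -, hα1, hβ1, h₁, h₂, h₃, -, hN2, hN3⟩ := id hE
  obtain ⟨hk, hloc, hout⟩ := modelToken_data hϖ h₁ h₂ hfoot ℓ ρ
  obtain ⟨hi1, hi2, -⟩ := isoceles_depths hϖ h₁ h₂ h₃
  have hn₃ : n₃ = n₂ := by
    rcases min_le_iff.1 hi1 with h | h <;> rcases min_le_iff.1 hi2 with h' | h' <;> omega
  have hvϖ0 : Valued.v ϖ ≠ 0 := by rw [hϖ]; exact exp_ne_zero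
  have hg₀ : Valued.v ((β - 1) / (α - 1)) = Valued.v ϖ ^ (2 * t') := v_glueUnit_eq hvϖ0 (hfoot ▸ h₁) h₂
  have hαd : Valued.v (α - 1) ≤ Valued.v ϖ ^ d := by rw [h₂]; exact pow_le_pow_right_of_le_one' (le_of_lt (ne_zero_and_v_lt_one_of_v_eq_exp hϖ).2) (by omega)
  have hβd : Valued.v (β - 1) ≤ Valued.v ϖ ^ d := by rw [h₁]; exact pow_le_pow_right_of_le_one' (le_of_lt (ne_zero_and_v_lt_one_of_v_eq_exp hϖ).2) (by omega)
  rw [finsum_stabiliserWeight_stratum_G1_sep_onLocus_tube hD h2 hE hT ρ t' hρ ht' ⟨by omega, htube⟩ ℓ n₂ _ hk hloc]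
  simp only [hout, glueRatio_modelToken_eq]
  by_cases hℓ : ℓ + ρ ≤ n₂
  · rw [if_pos hℓ, if_pos hℓ]
    by_cases hvac : ℓ + 2 * ρ ≤ n₂
    · rw [if_pos hvac, if_pos hvac]
    · rw [if_neg hvac, if_neg hvac]
      exact if_congr (by rw [exists_fixed_v_add_glueUnit_le_iff hσ hvσ hfix hϖ hd hd1 hαn hβn hα1 hβ1 hαd hβd h₃ (by omega) hg₀ (by omega),
        hn₃, show ℓ + 2 * ρ + 2 * t' - n₂ - 2 * t' = ℓ + 2 * ρ - n₂ by omega]) rfl rfl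
  · rw [if_neg hℓ, if_neg hℓ]

/-- **HEAD — THE LABELLED G1 WEIGHT FOR THE MODEL TOKEN `D₁ = diag(α−1, β−1, 0)` ON THE GLUE FOOT** (`n₁ = n₂ + 2t′`, `ρ ≤ n₂ < 2ρ`; level `ℓ`;
`E = ℓ + 2ρ + 2t′ − n₂`; the two balls are concentric, the token ball the finer): `Σᶠ_{M ∈ G1(2ρ, 2ρ+2t′, 2ρ+2t′), D₁M ⊆ ϖ^ℓM} 1∕[𝒰 : S_F(M)] =`
`[ℓ + ρ ≤ n₂ ∧ ℓ + 2ρ − n₂ ≤ n₂ − d + 1] · q^{2ρ+2t′−⌈E∕2⌉}` (§2's foot census + ★ bridge). [cite: Kottwitz1986BaseChangeUnits, §1 pp. 240–241]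
[cite: Serre1979, Ch. IV §2 Prop. 6] [cite: Rogawski1990, §4.9 Prop. 4.9.1 (a) p. 55] -/
theorem finsum_stabiliserWeight_stratum_G1_sep_modelToken_foot (hD : IsRamifiedQuadraticDatum σ ϖ d t) (h2 : Valued.v (2 : K) < 1)
    (hE : IsElementDatum σ ϖ N₀ α β n₁ n₂ n₃) (hN₀ : d ≤ N₀) (hT : (T : Matrix (Fin 3) (Fin 3) K) = Matrix.diagonal ![α, β, 1])
    (ρ t' : ℕ) (hρ : 1 ≤ ρ) (ht' : 1 ≤ t') (hfoot : n₁ = n₂ + 2 * t') (hρm : ρ ≤ n₂) (hm : n₂ < 2 * ρ) (ℓ : ℕ) :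
    ∑ᶠ M ∈ {M | M ∈ stratum σ ϖ T ![2 * ρ, 2 * ρ + 2 * t', 2 * ρ + 2 * t'] ∧ LatticeInLevel ϖ ℓ (Matrix.diagonal ![α - 1, β - 1, 0]) M},
        stabiliserWeight σ M =
      if ℓ + ρ ≤ n₂ ∧ ℓ + 2 * ρ - n₂ ≤ n₂ - d + 1 then (Fintype.card 𝓀[K] : ℚ) ^ (2 * ρ + 2 * t' - (ℓ + 2 * ρ + 2 * t' - n₂ + 1) / 2) else 0 := by
  classical
  obtain ⟨hσ, hvσ, hϖ, hfix, hd, hd1, -⟩ := id hD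
  obtain ⟨hαn, hβn, -, hα1, hβ1, h₁, h₂, h₃, -, hN2, hN3⟩ := id hE
  obtain ⟨hk, hloc, hout⟩ := modelToken_data hϖ h₁ h₂ hfoot ℓ ρ
  obtain ⟨hi1, hi2, -⟩ := isoceles_depths hϖ h₁ h₂ h₃
  have hn₃ : n₃ = n₂ := by
    rcases min_le_iff.1 hi1 with h | h <;> rcases min_le_iff.1 hi2 with h' | h' <;> omega
  have hvϖ0 : Valued.v ϖ ≠ 0 := by rw [hϖ]; exact exp_ne_zero
  have hg₀ : Valued.v ((β - 1) / (α - 1)) = Valued.v ϖ ^ (2 * t') := v_glueUnit_eq hvϖ0 (hfoot ▸ h₁) h₂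
  have hαd : Valued.v (α - 1) ≤ Valued.v ϖ ^ d := by rw [h₂]; exact pow_le_pow_right_of_le_one' (le_of_lt (ne_zero_and_v_lt_one_of_v_eq_exp hϖ).2) (by omega)
  have hβd : Valued.v (β - 1) ≤ Valued.v ϖ ^ d := by rw [h₁]; exact pow_le_pow_right_of_le_one' (le_of_lt (ne_zero_and_v_lt_one_of_v_eq_exp hϖ).2) (by omega)
  have hϖ1 : Valued.v ϖ ≤ 1 := le_of_lt (ne_zero_and_v_lt_one_of_v_eq_exp hϖ).2
  rw [finsum_stabiliserWeight_stratum_G1_sep_onLocus_foot hD h2 hE hT ρ t' hρ ht' hfoot hρm hm ℓ n₂ _ hk hloc]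
  simp only [hout, glueRatio_modelToken_eq]
  have hbridge := exists_fixed_v_add_glueUnit_le_iff hσ hvσ hfix hϖ hd hd1 hαn hβn hα1 hβ1 hαd hβd h₃ (by omega) hg₀
    (show 2 * t' ≤ ℓ + 2 * ρ + 2 * t' - n₂ by omega)
  rw [hn₃, show ℓ + 2 * ρ + 2 * t' - n₂ - 2 * t' = ℓ + 2 * ρ - n₂ by omega] at hbridge
  by_cases hℓ : ℓ + ρ ≤ n₂
  · rw [if_pos hℓ, if_neg (by omega : ¬ ℓ + 2 * ρ ≤ n₂), max_eq_right (by omega : 2 * ρ + 2 * t' - n₂ ≤ ℓ + 2 * ρ + 2 * t' - n₂)]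
    exact if_congr ⟨fun ⟨f, hσf, _, hf⟩ => ⟨hℓ, hbridge.1 ⟨f, hσf, hf⟩⟩, fun h => by
      obtain ⟨f₀, hσf₀, hf₀⟩ := hbridge.2 h.2
      exact ⟨f₀, hσf₀, hf₀.trans (pow_le_pow_right_of_le_one' hϖ1 (by omega)), hf₀⟩⟩ rfl rfl
  · rw [if_neg hℓ, if_neg (fun h => hℓ h.1)]

end Model

end Summit.HodgeConjecture.HodgeConjecture.Cruxes.H413.F0P3cDyRamLabelledGluedLocusCensusFoot

end
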